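import Mathlib.Analysis.Fourier.FourierTransformDeriv
import Mathlib.Analysis.SpecialFunctions.Pow.Deriv
import Mathlib.Analysis.SpecialFunctions.Pow.Continuity
import Mathlib.MeasureTheory.Integral.IntervalIntegral.IntegrationByParts
import Mathlib.Analysis.SpecialFunctions.Trigonometric.Bounds
import Mathlib.Analysis.Real.Pi.Bounds
import HarnessLib

/-!
# The Mellin transform of the twisted weight `v²(1−v)² e(λv)`

Topic `Literature/NumberTheory/Sieve`; a PROVED tool file toward
`Literature.NumberTheory.DiophantineGeometry.XYZUpperHalf` ([Harper2016, Cor. 1], our smoothed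
major-arc analysis). For the weight `w(v) = v²(1−v)²` on `[0,1]` and a frequency `λ ∈ ℝ`, the
Mellin transform of `w(v)e(λv)` at `s + 1`… precisely

`twistMellin λ s = ∫₀¹ v^{s+1} (1−v)² e(λv) dv`   (`= ∫₀^∞ v^{s−1} · w(v)e(λv) dv`),

and we prove the bounds used on the major arcs (for `Re s > 0`):

* `norm_twistMellin_le_one`: `|Ŵ_λ(s)| ≤ 1`;
* `norm_twistMellin_le_div`: `|Ŵ_λ(s)| ≤ (|s + 1| + 2)/(2π|λ|)` (one integration by parts in `e(λv)`,
  `integral_mul_fourierChar_parts`);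
* `norm_twistMellin_sub_le`: `|Ŵ_λ(σ+iτ) − Ŵ_λ(σ)| ≤ 2|τ|/(1 + |λ|)` for `σ ≥ 1/2`
  (from `norm_twistMellin_sub_le_abs`, `norm_twistMellin_sub_le_div`);
* `norm_twistMellin_le_decay`: `|Ŵ_λ(s)| ≤ (2 + 6(2π|λ|) + 6(2π|λ|)² + (2π|λ|)³)/(|s+2||s+3||s+4|)` (three
  integrations by parts in `v^{s+k}`, `integral_cpow_mul_parts`).

## References

* A. J. Harper, *Minor arcs, mean values, and restriction theory for exponential sums over smooth
  numbers*, Compositio Math. 152 (2016) 1121–1158, §5 (smoothed form of the major arcs) [Harper2016].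
* E. C. Titchmarsh, *The Theory of the Riemann Zeta-Function*, 2nd ed., §2.1 (Mellin pairs) [Titchmarsh1986].
-/

noncomputable section

open Real Complex MeasureTheory Set intervalIntegral
open scoped FourierTransform

namespace Literature.NumberTheory.Sieve

namespace TwistedWeight

/-- `Ŵ_λ(s) = ∫₀¹ v^{s+1}(1−v)² e(λv) dv`. [cite: Harper2016, §5] -/
def twistMellin (lam : ℝ) (s : ℂ) : ℂ :=
  ∫ v in (0 : ℝ)..1, (v : ℂ) ^ (s + 1) * ((((1 - v) ^ 2 : ℝ)) : ℂ) * (𝐞 (lam * v) : ℂ)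

/-- The norm of the integrand is `v^{Re s + 1}(1−v)² ≤ 1` on `[0,1]`. [folklore] -/
theorem norm_integrand_le {s : ℂ} (hs : 0 ≤ s.re) {v : ℝ} (hv0 : 0 ≤ v) (hv1 : v ≤ 1) (lam : ℝ) :
    ‖(v : ℂ) ^ (s + 1) * ((((1 - v) ^ 2 : ℝ)) : ℂ) * (𝐞 (lam * v) : ℂ)‖ ≤ 1 := by
  rw [norm_mul, norm_mul, Circle.norm_coe, mul_one, Complex.norm_real, Real.norm_eq_abs,
    abs_of_nonneg (by positivity)]
  have h1 : ‖(v : ℂ) ^ (s + 1)‖ ≤ 1 := by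
    rcases eq_or_lt_of_le hv0 with h0 | hpos
    · rw [← h0]; push_cast
      rw [Complex.zero_cpow (by
        intro h; have := congrArg Complex.re h; simp at this; linarith), norm_zero]
      exact zero_le_one
    · rw [Complex.norm_cpow_eq_rpow_re_of_pos hpos]
      exact Real.rpow_le_one hv0 hv1 (by simp; linarith)
  have h2 : (1 - v) ^ 2 ≤ 1 := by nlinarith
  calc ‖(v : ℂ) ^ (s + 1)‖ * (1 - v) ^ 2 ≤ 1 * 1 :=
        mul_le_mul h1 h2 (by positivity) zero_le_one
    _ = 1 := one_mul _

/-- `|Ŵ_λ(s)| ≤ 1` for `Re s ≥ 0`. [folklore] -/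
theorem norm_twistMellin_le_one {s : ℂ} (hs : 0 ≤ s.re) (lam : ℝ) : ‖twistMellin lam s‖ ≤ 1 := by
  unfold twistMellin
  calc ‖∫ v in (0 : ℝ)..1, (v : ℂ) ^ (s + 1) * ((((1 - v) ^ 2 : ℝ)) : ℂ) * (𝐞 (lam * v) : ℂ)‖
      ≤ 1 * |(1 : ℝ) - 0| := by
        refine intervalIntegral.norm_integral_le_of_norm_le_const fun v hv => ?_
        rw [uIoc_of_le zero_le_one, mem_Ioc] at hv
        exact norm_integrand_le hs hv.1.le hv.2 lam
    _ = 1 := by norm_num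

/-! ### One integration by parts in `e(λv)` -/

/-- The polynomial-power factor `u(v) = v^{s+1}(1−v)²` and its derivative. [folklore] -/
theorem hasDerivAt_powPoly {s : ℂ} {v : ℝ} (hv : v ≠ 0) :
    HasDerivAt (fun v : ℝ => (v : ℂ) ^ (s + 1) * ((((1 - v) ^ 2 : ℝ)) : ℂ))
      ((s + 1) * (v : ℂ) ^ s * ((((1 - v) ^ 2 : ℝ)) : ℂ) +
        (v : ℂ) ^ (s + 1) * (((-(2 * (1 - v)) : ℝ)) : ℂ)) v := by
  have h1 : HasDerivAt (fun v : ℝ => (v : ℂ) ^ (s + 1)) ((s + 1) * (v : ℂ) ^ s) v := by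
    rcases eq_or_ne (s + 1) 0 with h0 | h0
    · have : s = -1 := by linear_combination h0
      subst this
      simp only [neg_add_cancel, Complex.cpow_zero, zero_mul]
      exact hasDerivAt_const v 1
    · have := hasDerivAt_ofReal_cpow_const hv h0
      simpa using this
  have h2 : HasDerivAt (fun v : ℝ => ((((1 - v) ^ 2 : ℝ)) : ℂ)) (((-(2 * (1 - v)) : ℝ)) : ℂ) v := by
    have hsub : HasDerivAt (fun x : ℝ => 1 - x) (-1) v := by
      simpa using (hasDerivAt_id v).const_sub 1
    have h3 : HasDerivAt (fun x : ℝ => (1 - x) ^ 2) (-(2 * (1 - v))) v := by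
      have h4 := (hasDerivAt_pow 2 (1 - v)).comp v hsub
      refine HasDerivAt.congr_deriv (h4.congr_of_eventuallyEq (Filter.Eventually.of_forall fun x => rfl)) ?_
      push_cast; ring
    exact h3.ofReal_comp
  exact h1.mul h2

/-- Continuity of `v ↦ v^{z}` (real `v`, `Re z > 0`). [folklore] -/
theorem continuous_ofReal_cpow {z : ℂ} (hz : 0 < z.re) : Continuous (fun v : ℝ => (v : ℂ) ^ z) :=
  continuous_iff_continuousAt.mpr fun v => Complex.continuousAt_ofReal_cpow_const v z (Or.inl hz)

/-- `e(λ v)` has derivative `2πiλ e(λv)`. [folklore] -/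
theorem hasDerivAt_fourierChar_mul (lam v : ℝ) :
    HasDerivAt (fun v : ℝ => (𝐞 (lam * v) : ℂ)) (2 * π * I * lam * 𝐞 (lam * v)) v := by
  have hfun : (fun v : ℝ => (𝐞 (lam * v) : ℂ)) = fun v : ℝ => Complex.exp ((2 * π * I * lam) * (v : ℂ)) := by
    funext v
    rw [Real.fourierChar_apply]
    congr 1; push_cast; ring
  have h1 : HasDerivAt (fun v : ℝ => (2 * π * I * lam) * (v : ℂ)) (2 * π * I * lam) v := by
    simpa using (Complex.ofRealCLM.hasDerivAt (x := v)).const_mul (2 * π * I * lam)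
  have h2 := h1.cexp
  rw [hfun]
  convert h2 using 1
  rw [Real.fourierChar_apply]
  push_cast; ring_nf

/-- **Integration by parts in `e(λv)`**: for `Re s > 0` and `λ ≠ 0`,
`Ŵ_λ(s) = −(2πiλ)⁻¹ ∫₀¹ ((s+1)v^s(1−v)² − 2v^{s+1}(1−v)) e(λv) dv`. [folklore] -/
theorem twistMellin_eq_parts {s : ℂ} (hs : 0 < s.re) {lam : ℝ} (hlam : lam ≠ 0) :
    twistMellin lam s = -(1 / (2 * π * I * lam)) *
      ∫ v in (0 : ℝ)..1, ((s + 1) * (v : ℂ) ^ s * ((((1 - v) ^ 2 : ℝ)) : ℂ) +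
        (v : ℂ) ^ (s + 1) * (((-(2 * (1 - v)) : ℝ)) : ℂ)) * (𝐞 (lam * v) : ℂ) := by
  have hc : (2 * π * I * lam : ℂ) ≠ 0 := by
    simp [hlam, Real.pi_ne_zero, I_ne_zero]
  set u : ℝ → ℂ := fun v => (v : ℂ) ^ (s + 1) * ((((1 - v) ^ 2 : ℝ)) : ℂ) with hu
  set u' : ℝ → ℂ := fun v => (s + 1) * (v : ℂ) ^ s * ((((1 - v) ^ 2 : ℝ)) : ℂ) +
    (v : ℂ) ^ (s + 1) * (((-(2 * (1 - v)) : ℝ)) : ℂ) with hu'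
  set w : ℝ → ℂ := fun v => (𝐞 (lam * v) : ℂ) / (2 * π * I * lam) with hw
  set w' : ℝ → ℂ := fun v => (𝐞 (lam * v) : ℂ) with hw'
  have hs1 : 0 < (s + 1).re := by simp; linarith
  have hucont : Continuous u :=
    (continuous_ofReal_cpow hs1).mul (Complex.continuous_ofReal.comp (by fun_prop))
  have hu'cont : Continuous u' := by
    refine ((continuous_const.mul (continuous_ofReal_cpow hs)).mul
      (Complex.continuous_ofReal.comp (by fun_prop))).add
      ((continuous_ofReal_cpow hs1).mul (Complex.continuous_ofReal.comp (by fun_prop)))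
  have hw'cont : Continuous w' :=
    (fun v => (hasDerivAt_fourierChar_mul lam v).differentiableAt) |> fun h =>
      (show Differentiable ℝ w' from h).continuous
  have hwcont : Continuous w := hw'cont.div_const _
  have hww' : ∀ v : ℝ, HasDerivAt w (w' v) v := by
    intro v
    have := (hasDerivAt_fourierChar_mul lam v).div_const (2 * π * I * lam)
    rw [mul_div_cancel_left₀ _ hc] at this
    rw [hw, hw']
    exact this
  have key := intervalIntegral.integral_mul_deriv_eq_deriv_mul_of_hasDerivAt (a := (0 : ℝ)) (b := 1)
    (u := u) (v := w) (u' := u') (v' := w') hucont.continuousOn hwcont.continuousOn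
    (fun x hx => by
      rw [min_eq_left zero_le_one, max_eq_right zero_le_one] at hx
      exact hasDerivAt_powPoly hx.1.ne')
    (fun x _ => hww' x) (hu'cont.intervalIntegrable 0 1) (hw'cont.intervalIntegrable 0 1)
  have hu1 : u 1 = 0 := by simp [hu]
  have hu0 : u 0 = 0 := by
    simp only [hu, ofReal_zero]
    rw [Complex.zero_cpow (by intro h; have := congrArg Complex.re h; simp at this; linarith), zero_mul]
  rw [hu1, hu0, zero_mul, zero_mul, sub_zero, zero_sub] at key
  have e1 : twistMellin lam s = ∫ v in (0 : ℝ)..1, u v * w' v := rfl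
  rw [e1, key]
  have e2 : ∫ v in (0 : ℝ)..1, u' v * w v = (∫ v in (0 : ℝ)..1, u' v * w' v) / (2 * π * I * lam) := by
    rw [← intervalIntegral.integral_div]
    refine intervalIntegral.integral_congr fun v _ => ?_
    simp only [hw, hw']; ring
  rw [e2]
  show -((∫ v in (0 : ℝ)..1, u' v * w' v) / (2 * π * I * lam)) =
    -(1 / (2 * π * I * lam)) * ∫ v in (0 : ℝ)..1, u' v * w' v
  ring

/-- **The `1/λ` bound**: `|Ŵ_λ(s)| ≤ (|s + 1| + 2)/(2π|λ|)` for `Re s > 0`, `λ ≠ 0`. [folklore] -/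
theorem norm_twistMellin_le_div {s : ℂ} (hs : 0 < s.re) {lam : ℝ} (hlam : lam ≠ 0) :
    ‖twistMellin lam s‖ ≤ (‖s + 1‖ + 2) / (2 * π * |lam|) := by
  rw [twistMellin_eq_parts hs hlam, norm_mul, norm_neg, norm_div, norm_one]
  have hc : ‖(2 * π * I * lam : ℂ)‖ = 2 * π * |lam| := by
    rw [norm_mul, norm_mul, norm_mul, Complex.norm_I, mul_one, Complex.norm_real, Complex.norm_ofNat,
      Complex.norm_real, Real.norm_eq_abs, Real.norm_eq_abs, abs_of_pos Real.pi_pos]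
  rw [hc]
  have hint : ‖∫ v in (0 : ℝ)..1, ((s + 1) * (v : ℂ) ^ s * ((((1 - v) ^ 2 : ℝ)) : ℂ) +
      (v : ℂ) ^ (s + 1) * (((-(2 * (1 - v)) : ℝ)) : ℂ)) * (𝐞 (lam * v) : ℂ)‖ ≤ (‖s + 1‖ + 2) * |(1 : ℝ) - 0| := by
    refine intervalIntegral.norm_integral_le_of_norm_le_const fun v hv => ?_
    rw [uIoc_of_le zero_le_one, mem_Ioc] at hv
    obtain ⟨hv0, hv1⟩ := hv
    rw [norm_mul, Circle.norm_coe, mul_one]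
    have h1 : ‖(v : ℂ) ^ s‖ ≤ 1 := by
      rw [Complex.norm_cpow_eq_rpow_re_of_pos hv0]; exact Real.rpow_le_one hv0.le hv1 hs.le
    have h2 : ‖(v : ℂ) ^ (s + 1)‖ ≤ 1 := by
      rw [Complex.norm_cpow_eq_rpow_re_of_pos hv0]
      exact Real.rpow_le_one hv0.le hv1 (by simp; linarith)
    have h3 : ‖((((1 - v) ^ 2 : ℝ)) : ℂ)‖ ≤ 1 := by
      rw [Complex.norm_real, Real.norm_eq_abs, abs_of_nonneg (by positivity)]; nlinarith
    have h4 : ‖(((-(2 * (1 - v)) : ℝ)) : ℂ)‖ ≤ 2 := by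
      rw [Complex.norm_real, Real.norm_eq_abs, abs_neg, abs_of_nonneg (by linarith)]; linarith
    calc ‖(s + 1) * (v : ℂ) ^ s * ((((1 - v) ^ 2 : ℝ)) : ℂ) + (v : ℂ) ^ (s + 1) * (((-(2 * (1 - v)) : ℝ)) : ℂ)‖
        ≤ ‖(s + 1) * (v : ℂ) ^ s * ((((1 - v) ^ 2 : ℝ)) : ℂ)‖ + ‖(v : ℂ) ^ (s + 1) * (((-(2 * (1 - v)) : ℝ)) : ℂ)‖ :=
          norm_add_le _ _
      _ ≤ ‖s + 1‖ * 1 * 1 + 1 * 2 := by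
          rw [norm_mul, norm_mul, norm_mul]
          exact add_le_add (mul_le_mul (mul_le_mul_of_nonneg_left h1 (norm_nonneg _)) h3 (norm_nonneg _)
            (by positivity)) (mul_le_mul h2 h4 (norm_nonneg _) zero_le_one)
      _ = ‖s + 1‖ + 2 := by ring
  rw [show |(1 : ℝ) - 0| = 1 by norm_num, mul_one] at hint
  have hπ : 0 < 2 * π * |lam| := by have := Real.pi_pos; have := abs_pos.mpr hlam; positivity
  calc 1 / (2 * π * |lam|) * ‖∫ v in (0 : ℝ)..1, ((s + 1) * (v : ℂ) ^ s * ((((1 - v) ^ 2 : ℝ)) : ℂ) +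
        (v : ℂ) ^ (s + 1) * (((-(2 * (1 - v)) : ℝ)) : ℂ)) * (𝐞 (lam * v) : ℂ)‖
      ≤ 1 / (2 * π * |lam|) * (‖s + 1‖ + 2) := mul_le_mul_of_nonneg_left hint (by positivity)
    _ = (‖s + 1‖ + 2) / (2 * π * |lam|) := by ring

/-! ### The variation in `Im s` -/

/-- `‖e^{iu} - 1‖ ≤ |u|` (cf. `SmoothZetaLogDeriv`). [folklore] -/
private theorem norm_exp_mul_I_sub_one_le' (u : ℝ) : ‖Complex.exp (u * I) - 1‖ ≤ |u| := by
  have hsq : ‖Complex.exp (u * I) - 1‖ ^ 2 = 2 - 2 * Real.cos u := by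
    rw [Complex.exp_mul_I, Complex.sq_norm, Complex.normSq_apply, ← Complex.ofReal_cos,
      ← Complex.ofReal_sin]
    simp only [Complex.sub_re, Complex.one_re, Complex.add_re, Complex.ofReal_re, Complex.mul_re,
      Complex.I_re, Complex.ofReal_im, Complex.I_im, Complex.sub_im, Complex.one_im,
      Complex.add_im, Complex.mul_im]
    have := Real.sin_sq_add_cos_sq u
    nlinarith
  have hcos : 1 - Real.cos u ≤ u ^ 2 / 2 := by linarith [Real.one_sub_sq_div_two_le_cos (x := u)]
  have h2 : ‖Complex.exp (u * I) - 1‖ ^ 2 ≤ |u| ^ 2 := by rw [hsq, sq_abs]; linarith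
  exact (pow_le_pow_iff_left₀ (norm_nonneg _) (abs_nonneg _) two_ne_zero).1 h2

/-- `‖v^{iτ} - 1‖ ≤ |τ| |log v|` for `v > 0`, i.e. `‖v^{z + iτ} − v^z‖ ≤ v^{Re z} |τ| |log v|`. [folklore] -/
theorem norm_cpow_add_mul_I_sub_le {v : ℝ} (hv : 0 < v) (z : ℂ) (τ : ℝ) :
    ‖(v : ℂ) ^ (z + τ * I) - (v : ℂ) ^ z‖ ≤ v ^ z.re * (|τ| * |Real.log v|) := by
  have hv0 : (v : ℂ) ≠ 0 := by exact_mod_cast hv.ne'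
  rw [Complex.cpow_add _ _ hv0, ← mul_sub_one, norm_mul, Complex.norm_cpow_eq_rpow_re_of_pos hv]
  apply mul_le_mul_of_nonneg_left _ (by positivity)
  have : (v : ℂ) ^ ((τ : ℂ) * I) = Complex.exp ((τ * Real.log v : ℝ) * I) := by
    rw [Complex.cpow_def_of_ne_zero hv0, ← Complex.ofReal_log hv.le]
    congr 1; push_cast; ring
  rw [this]
  refine (norm_exp_mul_I_sub_one_le' _).trans (le_of_eq ?_)
  rw [abs_mul]

/-- The integrand is interval integrable (exponent with positive real part). [folklore] -/
theorem intervalIntegrable_integrand {z : ℂ} (hz : 0 < z.re) (lam : ℝ) :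
    IntervalIntegrable (fun v : ℝ => (v : ℂ) ^ z * ((((1 - v) ^ 2 : ℝ)) : ℂ) * (𝐞 (lam * v) : ℂ))
      volume 0 1 := by
  refine (Continuous.mul (Continuous.mul (continuous_ofReal_cpow hz) ?_) ?_).intervalIntegrable 0 1
  · exact Complex.continuous_ofReal.comp (by fun_prop)
  · exact continuous_iff_continuousAt.mpr fun v =>
      (hasDerivAt_fourierChar_mul lam v).differentiableAt.continuousAt

/-- **Variation in `Im s`, direct bound**: `‖Ŵ_λ(σ+iτ) − Ŵ_λ(σ)‖ ≤ |τ|` for `0 ≤ σ`. [folklore] -/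
theorem norm_twistMellin_sub_le_abs {σ : ℝ} (hσ : 0 ≤ σ) (τ lam : ℝ) :
    ‖twistMellin lam (σ + τ * I) - twistMellin lam σ‖ ≤ |τ| := by
  unfold twistMellin
  have hz1 : 0 < ((σ : ℂ) + τ * I + 1).re := by simp; linarith
  have hz2 : 0 < ((σ : ℂ) + 1).re := by simp; linarith
  rw [← intervalIntegral.integral_sub (intervalIntegrable_integrand hz1 lam) (intervalIntegrable_integrand hz2 lam)]
  calc ‖∫ v in (0 : ℝ)..1, ((v : ℂ) ^ ((σ : ℂ) + τ * I + 1) * ((((1 - v) ^ 2 : ℝ)) : ℂ) * (𝐞 (lam * v) : ℂ) -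
        (v : ℂ) ^ ((σ : ℂ) + 1) * ((((1 - v) ^ 2 : ℝ)) : ℂ) * (𝐞 (lam * v) : ℂ))‖
      ≤ |τ| * |(1 : ℝ) - 0| := by
        refine intervalIntegral.norm_integral_le_of_norm_le_const fun v hv => ?_
        rw [uIoc_of_le zero_le_one, mem_Ioc] at hv
        obtain ⟨hv0, hv1⟩ := hv
        rw [← sub_mul, ← sub_mul, norm_mul, norm_mul, Circle.norm_coe, mul_one, Complex.norm_real,
          Real.norm_eq_abs, abs_of_nonneg (by positivity)]
        have h1 : ‖(v : ℂ) ^ ((σ : ℂ) + τ * I + 1) - (v : ℂ) ^ ((σ : ℂ) + 1)‖ ≤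
            v ^ (σ + 1) * (|τ| * |Real.log v|) := by
          have := norm_cpow_add_mul_I_sub_le hv0 ((σ : ℂ) + 1) τ
          rw [show ((σ : ℂ) + 1 + τ * I) = (σ : ℂ) + τ * I + 1 by ring] at this
          refine this.trans (le_of_eq ?_)
          simp
        have h2 : v ^ (σ + 1) * (|τ| * |Real.log v|) ≤ |τ| := by
          have h3 : v ^ (σ + 1) ≤ v := by
            calc v ^ (σ + 1) ≤ v ^ (1 : ℝ) := Real.rpow_le_rpow_of_exponent_ge hv0 hv1 (by linarith)
              _ = v := Real.rpow_one v
          have h4 : |Real.log v * v| < 1 := Real.abs_log_mul_self_lt v hv0 hv1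
          rw [abs_mul, abs_of_pos hv0] at h4
          calc v ^ (σ + 1) * (|τ| * |Real.log v|) ≤ v * (|τ| * |Real.log v|) :=
                mul_le_mul_of_nonneg_right h3 (by positivity)
            _ = |τ| * (|Real.log v| * v) := by ring
            _ ≤ |τ| * 1 := mul_le_mul_of_nonneg_left h4.le (abs_nonneg _)
            _ = |τ| := mul_one _
        have h5 : (1 - v) ^ 2 ≤ 1 := by nlinarith
        calc ‖(v : ℂ) ^ ((σ : ℂ) + τ * I + 1) - (v : ℂ) ^ ((σ : ℂ) + 1)‖ * (1 - v) ^ 2 ≤ |τ| * 1 :=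
              mul_le_mul (h1.trans h2) h5 (by positivity) (abs_nonneg _)
          _ = |τ| := mul_one _
    _ = |τ| := by norm_num

/-- **Integration by parts against `e(λv)` on `[0,1]`** for `U` vanishing at both ends:
`∫₀¹ U e(λ·) = −(2πiλ)⁻¹ ∫₀¹ U' e(λ·)`. [folklore] -/
theorem integral_mul_fourierChar_parts {U U' : ℝ → ℂ} {lam : ℝ} (hU : ContinuousOn U (Icc 0 1))
    (hUU' : ∀ v ∈ Ioo (0 : ℝ) 1, HasDerivAt U (U' v) v) (hU' : IntervalIntegrable U' volume 0 1)
    (h0 : U 0 = 0) (h1 : U 1 = 0) (hlam : lam ≠ 0) :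
    ∫ v in (0 : ℝ)..1, U v * (𝐞 (lam * v) : ℂ) =
      -(1 / (2 * π * I * lam)) * ∫ v in (0 : ℝ)..1, U' v * (𝐞 (lam * v) : ℂ) := by
  have hc : (2 * π * I * lam : ℂ) ≠ 0 := by simp [hlam, Real.pi_ne_zero, I_ne_zero]
  set w : ℝ → ℂ := fun v => (𝐞 (lam * v) : ℂ) / (2 * π * I * lam) with hw
  set w' : ℝ → ℂ := fun v => (𝐞 (lam * v) : ℂ) with hw'
  have hw'cont : Continuous w' :=
    continuous_iff_continuousAt.mpr fun v => (hasDerivAt_fourierChar_mul lam v).differentiableAt.continuousAt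
  have hwcont : Continuous w := hw'cont.div_const _
  have hww' : ∀ v : ℝ, HasDerivAt w (w' v) v := by
    intro v
    have := (hasDerivAt_fourierChar_mul lam v).div_const (2 * π * I * lam)
    rw [mul_div_cancel_left₀ _ hc] at this
    rw [hw, hw']
    exact this
  have key := intervalIntegral.integral_mul_deriv_eq_deriv_mul_of_hasDerivAt (a := (0 : ℝ)) (b := 1)
    (u := U) (v := w) (u' := U') (v' := w') (by rwa [uIcc_of_le zero_le_one]) hwcont.continuousOn
    (fun x hx => by
      rw [min_eq_left zero_le_one, max_eq_right zero_le_one] at hx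
      exact hUU' x hx)
    (fun x _ => hww' x) hU' (hw'cont.intervalIntegrable 0 1)
  rw [h1, h0, zero_mul, zero_mul, sub_zero, zero_sub] at key
  have e1 : (∫ v in (0 : ℝ)..1, U v * (𝐞 (lam * v) : ℂ)) = ∫ v in (0 : ℝ)..1, U v * w' v := rfl
  rw [e1, key]
  have e2 : ∫ v in (0 : ℝ)..1, U' v * w v = (∫ v in (0 : ℝ)..1, U' v * w' v) / (2 * π * I * lam) := by
    rw [← intervalIntegral.integral_div]
    refine intervalIntegral.integral_congr fun v _ => ?_
    simp only [hw, hw']; ring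
  rw [e2]
  show -((∫ v in (0 : ℝ)..1, U' v * w' v) / (2 * π * I * lam)) =
    -(1 / (2 * π * I * lam)) * ∫ v in (0 : ℝ)..1, U' v * w' v
  ring

/-- `v^σ |log v| < 1/σ` on `(0,1]`, `σ > 0`. [folklore] -/
theorem rpow_mul_abs_log_lt {v σ : ℝ} (hv : 0 < v) (hv1 : v ≤ 1) (hσ : 0 < σ) :
    v ^ σ * |Real.log v| < 1 / σ := by
  have hw : 0 < v ^ σ := Real.rpow_pos_of_pos hv σ
  have hw1 : v ^ σ ≤ 1 := Real.rpow_le_one hv.le hv1 hσ.le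
  have h := Real.abs_log_mul_self_lt (v ^ σ) hw hw1
  rw [Real.log_rpow hv, abs_mul, abs_mul, abs_of_pos hσ, abs_of_pos hw] at h
  rw [lt_div_iff₀ hσ]
  nlinarith

/-- **Variation in `Im s`, the `1/λ` bound**: for `1/2 ≤ σ`, `λ ≠ 0`,
`‖Ŵ_λ(σ+iτ) − Ŵ_λ(σ)‖ ≤ 6|τ|/(2π|λ|)`. [folklore] -/
theorem norm_twistMellin_sub_le_div {σ : ℝ} (hσ : 1 / 2 ≤ σ) (τ : ℝ) {lam : ℝ}
    (hlam : lam ≠ 0) :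
    ‖twistMellin lam (σ + τ * I) - twistMellin lam σ‖ ≤ 6 * |τ| / (2 * π * |lam|) := by
  have hσ0 : 0 < σ := by linarith
  set z : ℂ := (σ : ℂ) + 1 with hz
  have hzre : z.re = σ + 1 := by simp [hz]
  -- `U(v) = (v^{z+τi} − v^z)(1−v)²`
  set U : ℝ → ℂ := fun v => ((v : ℂ) ^ (z + τ * I) - (v : ℂ) ^ z) * ((((1 - v) ^ 2 : ℝ)) : ℂ) with hU
  set U' : ℝ → ℂ := fun v => ((z + τ * I) * (v : ℂ) ^ (z + τ * I - 1) - z * (v : ℂ) ^ (z - 1)) *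
      ((((1 - v) ^ 2 : ℝ)) : ℂ) + ((v : ℂ) ^ (z + τ * I) - (v : ℂ) ^ z) * (((-(2 * (1 - v)) : ℝ)) : ℂ)
    with hU'
  have hz1 : 0 < (z + τ * I).re := by simp [hz]; linarith
  have hz2 : 0 < z.re := by rw [hzre]; linarith
  have hz3 : 0 < (z + τ * I - 1).re := by simp [hz]; linarith
  have hz4 : 0 < (z - 1).re := by simp [hz]; linarith
  have hUcont : Continuous U :=
    ((continuous_ofReal_cpow hz1).sub (continuous_ofReal_cpow hz2)).mul
      (Complex.continuous_ofReal.comp (by fun_prop))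
  have hU'cont : Continuous U' := by
    refine Continuous.add ?_ ?_
    · exact ((continuous_const.mul (continuous_ofReal_cpow hz3)).sub
        (continuous_const.mul (continuous_ofReal_cpow hz4))).mul (Complex.continuous_ofReal.comp (by fun_prop))
    · exact ((continuous_ofReal_cpow hz1).sub (continuous_ofReal_cpow hz2)).mul
        (Complex.continuous_ofReal.comp (by fun_prop))
  have hderiv : ∀ v ∈ Ioo (0 : ℝ) 1, HasDerivAt U (U' v) v := by
    intro v hv
    have hv0 : v ≠ 0 := hv.1.ne'
    have hne1 : z + τ * I ≠ 0 := by
      intro h; have := congrArg Complex.re h; simp [hz] at this; linarith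
    have hne2 : z ≠ 0 := by
      intro h; have := congrArg Complex.re h; simp [hz] at this; linarith
    have d1 := hasDerivAt_ofReal_cpow_const hv0 hne1
    have d2 := hasDerivAt_ofReal_cpow_const hv0 hne2
    have hsub : HasDerivAt (fun x : ℝ => 1 - x) (-1) v := by
      simpa using (hasDerivAt_id v).const_sub 1
    have d3 : HasDerivAt (fun x : ℝ => (1 - x) ^ 2) (-(2 * (1 - v))) v := by
      have h4 := (hasDerivAt_pow 2 (1 - v)).comp v hsub
      refine HasDerivAt.congr_deriv (h4.congr_of_eventuallyEq (Filter.Eventually.of_forall fun x => rfl)) ?_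
      push_cast; ring
    have d4 := (d1.fun_sub d2).fun_mul d3.ofReal_comp
    rw [hU, hU']
    refine d4.congr_deriv ?_
    push_cast; ring
  have hU0 : U 0 = 0 := by
    simp only [hU, ofReal_zero]
    have hne1 : z + τ * I ≠ 0 := by
      intro h; have := congrArg Complex.re h; simp [hz] at this; linarith
    have hne2 : z ≠ 0 := by
      intro h; have := congrArg Complex.re h; simp [hz] at this; linarith
    rw [Complex.zero_cpow hne1, Complex.zero_cpow hne2, sub_zero, zero_mul]
  have hU1 : U 1 = 0 := by simp [hU]
  have hparts := integral_mul_fourierChar_parts hUcont.continuousOn hderiv (hU'cont.intervalIntegrable 0 1)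
    hU0 hU1 hlam
  -- the difference of the two Mellin transforms is `∫ U e(λ·)`
  have hdiff : twistMellin lam (σ + τ * I) - twistMellin lam σ = ∫ v in (0 : ℝ)..1, U v * (𝐞 (lam * v) : ℂ) := by
    unfold twistMellin
    have hz1' : 0 < ((σ : ℂ) + τ * I + 1).re := by simp; linarith
    have hz2' : 0 < ((σ : ℂ) + 1).re := by simp; linarith
    rw [← intervalIntegral.integral_sub (intervalIntegrable_integrand hz1' lam) (intervalIntegrable_integrand hz2' lam)]
    refine intervalIntegral.integral_congr fun v _ => ?_
    simp only [hU, hz]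
    rw [show (σ : ℂ) + τ * I + 1 = (σ : ℂ) + 1 + τ * I by ring]
    ring
  rw [hdiff, hparts, norm_mul, norm_neg, norm_div, norm_one]
  have hc : ‖(2 * π * I * lam : ℂ)‖ = 2 * π * |lam| := by
    rw [norm_mul, norm_mul, norm_mul, Complex.norm_I, mul_one, Complex.norm_real, Complex.norm_ofNat,
      Complex.norm_real, Real.norm_eq_abs, Real.norm_eq_abs, abs_of_pos Real.pi_pos]
  rw [hc]
  -- pointwise bound `‖U'‖ ≤ 6 |τ|`
  have hpt : ∀ v ∈ Ioc (0 : ℝ) 1, ‖U' v * (𝐞 (lam * v) : ℂ)‖ ≤ 6 * |τ| := by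
    intro v hv
    obtain ⟨hv0, hv1⟩ := hv
    rw [norm_mul, Circle.norm_coe, mul_one, hU']
    simp only
    have hlog := rpow_mul_abs_log_lt hv0 hv1 hσ0
    have hvσ : v ^ σ ≤ 1 := Real.rpow_le_one hv0.le hv1 hσ0.le
    have hvσ1 : v ^ (σ + 1) ≤ v := by
      calc v ^ (σ + 1) ≤ v ^ (1 : ℝ) := Real.rpow_le_rpow_of_exponent_ge hv0 hv1 (by linarith)
        _ = v := Real.rpow_one v
    -- first bracket
    have hA : ‖(z + τ * I) * (v : ℂ) ^ (z + τ * I - 1) - z * (v : ℂ) ^ (z - 1)‖ ≤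
        (σ + 1) * (v ^ σ * |Real.log v|) * |τ| + |τ| * v ^ σ := by
      have e : (z + τ * I) * (v : ℂ) ^ (z + τ * I - 1) - z * (v : ℂ) ^ (z - 1) =
          z * ((v : ℂ) ^ ((z - 1) + τ * I) - (v : ℂ) ^ (z - 1)) + τ * I * (v : ℂ) ^ ((z - 1) + τ * I) := by
        rw [show z + τ * I - 1 = (z - 1) + τ * I by ring]; ring
      rw [e]
      refine (norm_add_le _ _).trans ?_
      have h1 : ‖z * ((v : ℂ) ^ ((z - 1) + τ * I) - (v : ℂ) ^ (z - 1))‖ ≤ (σ + 1) * (v ^ σ * |Real.log v|) * |τ| := by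
        rw [norm_mul]
        have hzn : ‖z‖ = σ + 1 := by
          rw [hz, show (σ : ℂ) + 1 = ((σ + 1 : ℝ) : ℂ) by push_cast; ring, Complex.norm_real,
            Real.norm_eq_abs, abs_of_pos (by linarith)]
        rw [hzn]
        have := norm_cpow_add_mul_I_sub_le hv0 (z - 1) τ
        rw [show (z - 1).re = σ by simp [hz]] at this
        calc (σ + 1) * ‖(v : ℂ) ^ ((z - 1) + τ * I) - (v : ℂ) ^ (z - 1)‖ ≤ (σ + 1) * (v ^ σ * (|τ| * |Real.log v|)) :=
              mul_le_mul_of_nonneg_left this (by linarith)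
          _ = (σ + 1) * (v ^ σ * |Real.log v|) * |τ| := by ring
      have h2 : ‖(τ : ℂ) * I * (v : ℂ) ^ ((z - 1) + τ * I)‖ ≤ |τ| * v ^ σ := by
        rw [norm_mul, norm_mul, Complex.norm_I, mul_one, Complex.norm_real, Real.norm_eq_abs,
          Complex.norm_cpow_eq_rpow_re_of_pos hv0]
        simp [hz]
      exact add_le_add h1 h2
    have hB : ‖(v : ℂ) ^ (z + τ * I) - (v : ℂ) ^ z‖ ≤ v * |τ| * |Real.log v| := by
      have := norm_cpow_add_mul_I_sub_le hv0 z τ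
      rw [hzre] at this
      calc ‖(v : ℂ) ^ (z + τ * I) - (v : ℂ) ^ z‖ ≤ v ^ (σ + 1) * (|τ| * |Real.log v|) := this
        _ ≤ v * (|τ| * |Real.log v|) := mul_le_mul_of_nonneg_right hvσ1 (by positivity)
        _ = v * |τ| * |Real.log v| := by ring
    have hC : ‖((((1 - v) ^ 2 : ℝ)) : ℂ)‖ ≤ 1 := by
      rw [Complex.norm_real, Real.norm_eq_abs, abs_of_nonneg (by positivity)]; nlinarith
    have hD : ‖(((-(2 * (1 - v)) : ℝ)) : ℂ)‖ ≤ 2 := by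
      rw [Complex.norm_real, Real.norm_eq_abs, abs_neg, abs_of_nonneg (by linarith)]; linarith
    have hvlog : v * |Real.log v| < 1 := by
      have := Real.abs_log_mul_self_lt v hv0 hv1
      rwa [abs_mul, abs_of_pos hv0, mul_comm] at this
    calc ‖((z + τ * I) * (v : ℂ) ^ (z + τ * I - 1) - z * (v : ℂ) ^ (z - 1)) * ((((1 - v) ^ 2 : ℝ)) : ℂ) +
          ((v : ℂ) ^ (z + τ * I) - (v : ℂ) ^ z) * (((-(2 * (1 - v)) : ℝ)) : ℂ)‖
        ≤ ‖((z + τ * I) * (v : ℂ) ^ (z + τ * I - 1) - z * (v : ℂ) ^ (z - 1))‖ * ‖((((1 - v) ^ 2 : ℝ)) : ℂ)‖ +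
            ‖(v : ℂ) ^ (z + τ * I) - (v : ℂ) ^ z‖ * ‖(((-(2 * (1 - v)) : ℝ)) : ℂ)‖ := by
          rw [← norm_mul, ← norm_mul]; exact norm_add_le _ _
      _ ≤ ((σ + 1) * (v ^ σ * |Real.log v|) * |τ| + |τ| * v ^ σ) * 1 + (v * |τ| * |Real.log v|) * 2 :=
          add_le_add (mul_le_mul hA hC (norm_nonneg _) (by positivity))
            (mul_le_mul hB hD (norm_nonneg _) (by positivity))
      _ ≤ 6 * |τ| := by
          -- `(σ+1) v^σ|log v| ≤ (σ+1)/σ ≤ 3`, `v^σ ≤ 1`, `v|log v| ≤ 1`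
          have h1 : (σ + 1) * (v ^ σ * |Real.log v|) ≤ 3 := by
            have h2 : (σ + 1) * (1 / σ) ≤ 3 := by
              rw [mul_one_div, div_le_iff₀ hσ0]; linarith
            calc (σ + 1) * (v ^ σ * |Real.log v|) ≤ (σ + 1) * (1 / σ) :=
                  mul_le_mul_of_nonneg_left hlog.le (by linarith)
              _ ≤ 3 := h2
          have hτ0 : 0 ≤ |τ| := abs_nonneg τ
          nlinarith [hvlog, hvσ, h1, mul_nonneg hτ0 (show 0 ≤ v ^ σ * |Real.log v| by positivity)]
  have hint : ‖∫ v in (0 : ℝ)..1, U' v * (𝐞 (lam * v) : ℂ)‖ ≤ 6 * |τ| * |(1 : ℝ) - 0| := by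
    refine intervalIntegral.norm_integral_le_of_norm_le_const fun v hv => ?_
    rw [uIoc_of_le zero_le_one] at hv
    exact hpt v hv
  rw [show |(1 : ℝ) - 0| = 1 by norm_num, mul_one] at hint
  have hπ : 0 < 2 * π * |lam| := by have := Real.pi_pos; have := abs_pos.mpr hlam; positivity
  calc 1 / (2 * π * |lam|) * ‖∫ v in (0 : ℝ)..1, U' v * (𝐞 (lam * v) : ℂ)‖
      ≤ 1 / (2 * π * |lam|) * (6 * |τ|) := mul_le_mul_of_nonneg_left hint (by positivity)
    _ = 6 * |τ| / (2 * π * |lam|) := by ring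

/-- **Variation in `Im s`, combined**: `‖Ŵ_λ(σ+iτ) − Ŵ_λ(σ)‖ ≤ 2|τ|/(1+|λ|)` for `1/2 ≤ σ`.
[folklore] -/
theorem norm_twistMellin_sub_le {σ : ℝ} (hσ : 1 / 2 ≤ σ) (τ lam : ℝ) :
    ‖twistMellin lam (σ + τ * I) - twistMellin lam σ‖ ≤ 2 * |τ| / (1 + |lam|) := by
  have hτ0 : 0 ≤ |τ| := abs_nonneg τ
  rcases le_or_gt |lam| 1 with hsmall | hbig
  · have h := norm_twistMellin_sub_le_abs (by linarith : (0 : ℝ) ≤ σ) τ lam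
    refine h.trans ?_
    rw [le_div_iff₀ (by positivity)]; nlinarith
  · have hlam : lam ≠ 0 := by intro h; rw [h, abs_zero] at hbig; linarith
    have h := norm_twistMellin_sub_le_div hσ τ hlam
    refine h.trans ?_
    have hπ := Real.pi_gt_three
    rw [div_le_div_iff₀ (by positivity) (by positivity)]
    have h1 : 6 * (1 + |lam|) ≤ 2 * (2 * π * |lam|) := by nlinarith
    have key := mul_le_mul_of_nonneg_left h1 hτ0
    linarith

/-! ### Three integrations by parts in `v^{s+k}`: decay in `|s|` -/

/-- **Integration by parts against `v^z`** (`Re z > 0`): for `h ∈ C¹(ℝ)`,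
`∫₀¹ v^z h(v) dv = h(1)/(z+1) − (z+1)⁻¹ ∫₀¹ v^{z+1} h'(v) dv`. [folklore] -/
theorem integral_cpow_mul_parts {z : ℂ} (hz : 0 < z.re) {h h' : ℝ → ℂ}
    (hh : ∀ v, HasDerivAt h (h' v) v) (hcont' : Continuous h') :
    ∫ v in (0 : ℝ)..1, (v : ℂ) ^ z * h v =
      h 1 / (z + 1) - (1 / (z + 1)) * ∫ v in (0 : ℝ)..1, (v : ℂ) ^ (z + 1) * h' v := by
  have hz1 : z + 1 ≠ 0 := by
    intro h0; have := congrArg Complex.re h0; simp at this; linarith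
  have hz1re : 0 < (z + 1).re := by simp; linarith
  set V : ℝ → ℂ := fun v => (v : ℂ) ^ (z + 1) / (z + 1) with hV
  have hVcont : Continuous V := (continuous_ofReal_cpow hz1re).div_const _
  have hV' : ∀ v ∈ Ioo (0 : ℝ) 1, HasDerivAt V ((v : ℂ) ^ z) v := by
    intro v hv
    have := hasDerivAt_ofReal_cpow_const' hv.1.ne' (r := z) (by
      intro h0; have := congrArg Complex.re h0; simp at this; linarith)
    exact this
  have hcont : Continuous h := continuous_iff_continuousAt.mpr fun v => (hh v).differentiableAt.continuousAt
  have key := intervalIntegral.integral_mul_deriv_eq_deriv_mul_of_hasDerivAt (a := (0 : ℝ)) (b := 1)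
    (u := h) (v := V) (u' := h') (v' := fun v : ℝ => (v : ℂ) ^ z) hcont.continuousOn hVcont.continuousOn
    (fun x _ => hh x)
    (fun x hx => by
      rw [min_eq_left zero_le_one, max_eq_right zero_le_one] at hx
      exact hV' x hx)
    (hcont'.intervalIntegrable 0 1) ((continuous_ofReal_cpow hz).intervalIntegrable 0 1)
  have hV0 : V 0 = 0 := by
    simp only [hV, ofReal_zero]; rw [Complex.zero_cpow hz1, zero_div]
  have hV1 : V 1 = 1 / (z + 1) := by simp [hV]
  rw [hV0, hV1, mul_zero, sub_zero] at key
  calc ∫ v in (0 : ℝ)..1, (v : ℂ) ^ z * h v = ∫ v in (0 : ℝ)..1, h v * (v : ℂ) ^ z := by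
        refine intervalIntegral.integral_congr fun v _ => ?_; ring
    _ = h 1 * (1 / (z + 1)) - ∫ v in (0 : ℝ)..1, h' v * V v := key
    _ = h 1 / (z + 1) - (1 / (z + 1)) * ∫ v in (0 : ℝ)..1, (v : ℂ) ^ (z + 1) * h' v := by
        have e : ∫ v in (0 : ℝ)..1, h' v * V v = (1 / (z + 1)) * ∫ v in (0 : ℝ)..1, (v : ℂ) ^ (z + 1) * h' v := by
          rw [← intervalIntegral.integral_const_mul]
          refine intervalIntegral.integral_congr fun v _ => ?_
          simp only [hV]; ring
        rw [e]; ring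

/-- Product rule for `P(v) exp(cv)` (real variable, complex `c`). [folklore] -/
theorem hasDerivAt_poly_mul_exp {P : ℝ → ℂ} {p' : ℂ} (c : ℂ) {v : ℝ} (hP : HasDerivAt P p' v) :
    HasDerivAt (fun v : ℝ => P v * Complex.exp (c * v)) ((p' + c * P v) * Complex.exp (c * v)) v := by
  have h1 : HasDerivAt (fun v : ℝ => Complex.exp (c * v)) (c * Complex.exp (c * v)) v := by
    have h2 : HasDerivAt (fun v : ℝ => c * (v : ℂ)) c v := by
      simpa using (Complex.ofRealCLM.hasDerivAt (x := v)).const_mul c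
    simpa [mul_comm] using h2.cexp
  have := hP.mul h1
  refine this.congr_deriv ?_
  ring

/-- `|exp(2πiλv)| = 1`. [folklore] -/
theorem norm_exp_twoPiI_mul (lam v : ℝ) : ‖Complex.exp (2 * π * I * lam * v)‖ = 1 := by
  rw [show (2 * π * I * lam * v : ℂ) = ((2 * π * lam * v : ℝ) : ℂ) * I by push_cast; ring,
    Complex.norm_exp_ofReal_mul_I]

/-- **Decay in `|s|`**: for `Re s > 0`,
`‖Ŵ_λ(s)‖ ≤ (2 + 6(2π|λ|) + 6(2π|λ|)² + (2π|λ|)³)/(|s+2| |s+3| |s+4|)`. [folklore] -/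
theorem norm_twistMellin_le_decay {s : ℂ} (hs : 0 < s.re) (lam : ℝ) :
    ‖twistMellin lam s‖ ≤ (2 + 6 * (2 * π * |lam|) + 6 * (2 * π * |lam|) ^ 2 + (2 * π * |lam|) ^ 3) /
      (‖s + 2‖ * ‖s + 3‖ * ‖s + 4‖) := by
  set c : ℂ := 2 * π * I * lam with hc
  have hcn : ‖c‖ = 2 * π * |lam| := by
    rw [hc, norm_mul, norm_mul, norm_mul, Complex.norm_I, mul_one, Complex.norm_real, Complex.norm_ofNat,
      Complex.norm_real, Real.norm_eq_abs, Real.norm_eq_abs, abs_of_pos Real.pi_pos]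
  -- the amplitudes
  set g0 : ℝ → ℂ := fun v => ((((1 - v) ^ 2 : ℝ)) : ℂ) * Complex.exp (c * v) with hg0
  set g1 : ℝ → ℂ := fun v => ((((-(2 * (1 - v))) : ℝ) : ℂ) + c * ((((1 - v) ^ 2 : ℝ)) : ℂ)) *
    Complex.exp (c * v) with hg1
  set g2 : ℝ → ℂ := fun v => ((2 : ℂ) + (2 * c * ((((-(2 * (1 - v))) : ℝ) : ℂ)) + c ^ 2 * ((((1 - v) ^ 2 : ℝ)) : ℂ))) *
    Complex.exp (c * v) with hg2
  set g3 : ℝ → ℂ := fun v => (6 * c + (3 * c ^ 2 * ((((-(2 * (1 - v))) : ℝ) : ℂ)) + c ^ 3 * ((((1 - v) ^ 2 : ℝ)) : ℂ))) *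
    Complex.exp (c * v) with hg3
  have hsub : ∀ v : ℝ, HasDerivAt (fun x : ℝ => 1 - x) (-1) v := fun v => by
    simpa using (hasDerivAt_id v).const_sub 1
  have hsq : ∀ v : ℝ, HasDerivAt (fun x : ℝ => ((((1 - x) ^ 2 : ℝ)) : ℂ)) ((((-(2 * (1 - v))) : ℝ) : ℂ)) v := by
    intro v
    have h4 := (hasDerivAt_pow 2 (1 - v)).comp v (hsub v)
    have h5 : HasDerivAt (fun x : ℝ => (1 - x) ^ 2) (-(2 * (1 - v))) v := by
      refine HasDerivAt.congr_deriv (h4.congr_of_eventuallyEq (Filter.Eventually.of_forall fun x => rfl)) ?_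
      push_cast; ring
    exact h5.ofReal_comp
  have hlin : ∀ v : ℝ, HasDerivAt (fun x : ℝ => ((((-(2 * (1 - x))) : ℝ) : ℂ))) (2 : ℂ) v := by
    intro v
    have h5 : HasDerivAt (fun x : ℝ => -(2 * (1 - x))) 2 v := by
      have := (hsub v).const_mul 2 |>.neg
      refine this.congr_deriv ?_; ring
    have := h5.ofReal_comp
    simpa using this
  have hd0 : ∀ v, HasDerivAt g0 (g1 v) v := by
    intro v
    have := hasDerivAt_poly_mul_exp c (hsq v)
    rw [hg0, hg1]
    exact this
  have hd1 : ∀ v, HasDerivAt g1 (g2 v) v := by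
    intro v
    have hP : HasDerivAt (fun x : ℝ => ((((-(2 * (1 - x))) : ℝ) : ℂ) + c * (((1 - x) ^ 2 : ℝ) : ℂ)))
        ((2 : ℂ) + c * (((-(2 * (1 - v))) : ℝ) : ℂ)) v := (hlin v).add ((hsq v).const_mul c)
    have := hasDerivAt_poly_mul_exp c hP
    rw [hg1, hg2]
    refine this.congr_deriv ?_
    ring
  have hd2 : ∀ v, HasDerivAt g2 (g3 v) v := by
    intro v
    have hP : HasDerivAt (fun x : ℝ => (2 : ℂ) + (2 * c * (((-(2 * (1 - x))) : ℝ) : ℂ) + c ^ 2 * (((1 - x) ^ 2 : ℝ) : ℂ)))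
        (2 * c * 2 + c ^ 2 * (((-(2 * (1 - v))) : ℝ) : ℂ)) v :=
      (((hlin v).const_mul (2 * c)).add ((hsq v).const_mul (c ^ 2))).const_add (2 : ℂ)
    have := hasDerivAt_poly_mul_exp c hP
    rw [hg2, hg3]
    refine this.congr_deriv ?_
    ring
  -- continuity
  have hexpc : Continuous fun v : ℝ => Complex.exp (c * v) := by fun_prop
  have hg1c : Continuous g1 := continuous_iff_continuousAt.mpr fun v => (hd1 v).differentiableAt.continuousAt
  have hg2c : Continuous g2 := continuous_iff_continuousAt.mpr fun v => (hd2 v).differentiableAt.continuousAt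
  have hg3c : Continuous g3 := by rw [hg3]; fun_prop
  -- the three integrations by parts
  have hs1 : 0 < (s + 1).re := by simp; linarith
  have hs2 : 0 < (s + 2).re := by simp; linarith
  have hs3 : 0 < (s + 3).re := by simp; linarith
  have e0 : twistMellin lam s = ∫ v in (0 : ℝ)..1, (v : ℂ) ^ (s + 1) * g0 v := by
    unfold twistMellin
    refine intervalIntegral.integral_congr fun v _ => ?_
    simp only [hg0, hc]
    rw [mul_assoc]
    congr 1
    congr 1
    rw [Real.fourierChar_apply]; congr 1; push_cast; ring
  have e1 := integral_cpow_mul_parts hs1 hd0 hg1c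
  have e2 := integral_cpow_mul_parts hs2 hd1 hg2c
  have e3 := integral_cpow_mul_parts hs3 hd2 hg3c
  have hg0_1 : g0 1 = 0 := by simp [hg0]
  have hg1_1 : g1 1 = 0 := by simp [hg1]
  have hg2_1 : g2 1 = 2 * Complex.exp c := by simp [hg2]
  rw [show s + 1 + 1 = s + 2 by ring] at e1
  rw [show s + 2 + 1 = s + 3 by ring] at e2
  rw [show s + 3 + 1 = s + 4 by ring] at e3
  rw [hg0_1, zero_div, zero_sub] at e1
  rw [hg1_1, zero_div, zero_sub] at e2
  rw [hg2_1] at e3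
  have hW : twistMellin lam s = (1 / (s + 2)) * ((1 / (s + 3)) *
      (2 * Complex.exp c / (s + 4) - (1 / (s + 4)) * ∫ v in (0 : ℝ)..1, (v : ℂ) ^ (s + 4) * g3 v)) := by
    rw [e0, e1, e2, e3]; ring
  -- the bound
  have hne2 : s + 2 ≠ 0 := by intro h; have := congrArg Complex.re h; simp at this; linarith
  have hne3 : s + 3 ≠ 0 := by intro h; have := congrArg Complex.re h; simp at this; linarith
  have hne4 : s + 4 ≠ 0 := by intro h; have := congrArg Complex.re h; simp at this; linarith
  have hg3b : ∀ v ∈ Ioc (0 : ℝ) 1, ‖(v : ℂ) ^ (s + 4) * g3 v‖ ≤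
      6 * (2 * π * |lam|) + 6 * (2 * π * |lam|) ^ 2 + (2 * π * |lam|) ^ 3 := by
    intro v hv
    obtain ⟨hv0, hv1⟩ := hv
    have hpow : ‖(v : ℂ) ^ (s + 4)‖ ≤ 1 := by
      rw [Complex.norm_cpow_eq_rpow_re_of_pos hv0]
      exact Real.rpow_le_one hv0.le hv1 (by simp; linarith)
    have hE : ‖Complex.exp (c * v)‖ = 1 := by rw [hc]; exact norm_exp_twoPiI_mul lam v
    have hA : ‖((((-(2 * (1 - v))) : ℝ) : ℂ))‖ ≤ 2 := by
      rw [Complex.norm_real, Real.norm_eq_abs, abs_neg, abs_of_nonneg (by linarith)]; linarith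
    have hB : ‖((((1 - v) ^ 2 : ℝ)) : ℂ)‖ ≤ 1 := by
      rw [Complex.norm_real, Real.norm_eq_abs, abs_of_nonneg (by positivity)]; nlinarith
    have hpoly : ‖6 * c + (3 * c ^ 2 * ((((-(2 * (1 - v))) : ℝ) : ℂ)) + c ^ 3 * ((((1 - v) ^ 2 : ℝ)) : ℂ))‖ ≤
        6 * (2 * π * |lam|) + 6 * (2 * π * |lam|) ^ 2 + (2 * π * |lam|) ^ 3 := by
      calc ‖6 * c + (3 * c ^ 2 * ((((-(2 * (1 - v))) : ℝ) : ℂ)) + c ^ 3 * ((((1 - v) ^ 2 : ℝ)) : ℂ))‖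
          ≤ ‖6 * c‖ + (‖3 * c ^ 2 * ((((-(2 * (1 - v))) : ℝ) : ℂ))‖ + ‖c ^ 3 * ((((1 - v) ^ 2 : ℝ)) : ℂ)‖) :=
            (norm_add_le _ _).trans (add_le_add le_rfl (norm_add_le _ _))
        _ ≤ 6 * ‖c‖ + (3 * ‖c‖ ^ 2 * 2 + ‖c‖ ^ 3 * 1) := by
            have e1 : ‖(6 : ℂ) * c‖ = 6 * ‖c‖ := by rw [norm_mul (6 : ℂ) c, Complex.norm_ofNat]
            have e2 : ‖(3 : ℂ) * c ^ 2 * ((((-(2 * (1 - v))) : ℝ) : ℂ))‖ ≤ 3 * ‖c‖ ^ 2 * 2 := by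
              rw [norm_mul ((3 : ℂ) * c ^ 2) _, norm_mul (3 : ℂ) (c ^ 2), norm_pow c 2, Complex.norm_ofNat]
              exact mul_le_mul_of_nonneg_left hA (by positivity)
            have e3 : ‖c ^ 3 * ((((1 - v) ^ 2 : ℝ)) : ℂ)‖ ≤ ‖c‖ ^ 3 * 1 := by
              rw [norm_mul (c ^ 3) _, norm_pow c 3]
              exact mul_le_mul_of_nonneg_left hB (by positivity)
            rw [e1]
            exact add_le_add le_rfl (add_le_add e2 e3)
        _ = _ := by rw [hcn]; ring
    rw [norm_mul, hg3]
    simp only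
    rw [norm_mul, hE, mul_one]
    calc ‖(v : ℂ) ^ (s + 4)‖ * ‖6 * c + (3 * c ^ 2 * ((((-(2 * (1 - v))) : ℝ) : ℂ)) + c ^ 3 * ((((1 - v) ^ 2 : ℝ)) : ℂ))‖
        ≤ 1 * (6 * (2 * π * |lam|) + 6 * (2 * π * |lam|) ^ 2 + (2 * π * |lam|) ^ 3) :=
          mul_le_mul hpow hpoly (norm_nonneg _) zero_le_one
      _ = _ := one_mul _
  have hint : ‖∫ v in (0 : ℝ)..1, (v : ℂ) ^ (s + 4) * g3 v‖ ≤
      6 * (2 * π * |lam|) + 6 * (2 * π * |lam|) ^ 2 + (2 * π * |lam|) ^ 3 := by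
    have := intervalIntegral.norm_integral_le_of_norm_le_const (a := (0 : ℝ)) (b := 1)
      (f := fun v : ℝ => (v : ℂ) ^ (s + 4) * g3 v)
      (C := 6 * (2 * π * |lam|) + 6 * (2 * π * |lam|) ^ 2 + (2 * π * |lam|) ^ 3)
      (fun v hv => by rw [uIoc_of_le zero_le_one] at hv; exact hg3b v hv)
    simpa using this
  have hexp1 : ‖Complex.exp c‖ = 1 := by
    have := norm_exp_twoPiI_mul lam 1; rw [← hc] at this; simpa using this
  have hn2 : 0 < ‖s + 2‖ := norm_pos_iff.mpr hne2
  have hn3 : 0 < ‖s + 3‖ := norm_pos_iff.mpr hne3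
  have hn4 : 0 < ‖s + 4‖ := norm_pos_iff.mpr hne4
  set X : ℂ := 2 * Complex.exp c / (s + 4) - 1 / (s + 4) * ∫ v in (0 : ℝ)..1, (v : ℂ) ^ (s + 4) * g3 v with hX
  have hXb : ‖X‖ ≤ (2 + (6 * (2 * π * |lam|) + 6 * (2 * π * |lam|) ^ 2 + (2 * π * |lam|) ^ 3)) / ‖s + 4‖ := by
    calc ‖X‖ ≤ ‖2 * Complex.exp c / (s + 4)‖ + ‖1 / (s + 4) * ∫ v in (0 : ℝ)..1, (v : ℂ) ^ (s + 4) * g3 v‖ :=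
          norm_sub_le _ _
      _ = (2 + ‖∫ v in (0 : ℝ)..1, (v : ℂ) ^ (s + 4) * g3 v‖) / ‖s + 4‖ := by
          rw [norm_div, norm_mul, Complex.norm_ofNat, hexp1, mul_one, norm_mul, norm_div, norm_one]
          ring
      _ ≤ (2 + (6 * (2 * π * |lam|) + 6 * (2 * π * |lam|) ^ 2 + (2 * π * |lam|) ^ 3)) / ‖s + 4‖ := by
          gcongr
  calc ‖twistMellin lam s‖ = ‖X‖ / (‖s + 2‖ * ‖s + 3‖) := by
        rw [hW, norm_mul, norm_mul, norm_div, norm_div, norm_one]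
        field_simp
    _ ≤ ((2 + (6 * (2 * π * |lam|) + 6 * (2 * π * |lam|) ^ 2 + (2 * π * |lam|) ^ 3)) / ‖s + 4‖) /
          (‖s + 2‖ * ‖s + 3‖) := div_le_div_of_nonneg_right hXb (by positivity)
    _ = (2 + 6 * (2 * π * |lam|) + 6 * (2 * π * |lam|) ^ 2 + (2 * π * |lam|) ^ 3) /
          (‖s + 2‖ * ‖s + 3‖ * ‖s + 4‖) := by
        field_simp
        ring

end TwistedWeight

end Literature.NumberTheory.Sieve

end
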